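import Mathlib
import HarnessLib
import Summits.RiemannHypothesis.RiemannHypothesis.Theorems.EarlyAppointmentsRemainder0XiEtaLedgerArith
import Summits.RiemannHypothesis.RiemannHypothesis.Theorems.EarlyAppointmentsRemainder0XiStubFarLogKernelSharp

/-!
# ⟨24730⟩ ρ2 v4 — LEAF 1 (`KernelShiftLeaf`): the CLOSED NUMERIC INEQUALITY `leaf1Bound x ≤ 0.0105 · log(γ/2π)` PROVED

C4 «kernel desk» rh-idea-6 g31 (successor of g30), director (CA406)(d); constants priced by C3 g41 (RESULT-17, table `K4C`:
`cS = 105/10000`).  SUPPORT module for crux r3 `Remainder0Xi` (stmt-RiemannHypothesis-24730), line `rho2_v4`, stub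
`stub_farAbel4`.  Fully proved, standard axioms; imports: Mathlib, HarnessLib and the LANDED tree module `…EtaLedgerArith`
(`T_PT = 3000175332800`, `boxHalfWidth = 135/2`) and `…StubFarLogKernelSharp` (`RegistryForm.log_div_twoPi_ge`) — both in the
tree: landable at once, no queue dependency.

After …KernelShiftSum (`kernelShiftLeaf_of_heightBound`), …KernelLowSide (`lowHalf_sq_bound`, `integral_psiDn_log_le`),
…KernelHighSide (`highSide_tendsto_sq`, `abs_Fsq_le`, `integral_psiUp_div_le`) and …KernelHighMain
(`integral_psiUp_log_le_uniform`), LEAF 1 at the box `|x − γ| ≤ 67.5`, `γ > T_PT`, is bounded (eventually in the truncation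
height `T`, up to `ε`) by the explicit real number `leaf1Bound x` below: lower Abel side on `(0, x − 67.5]` + upper
Brent–Platt–Trudgian side on `(x + 66.5, T]` (the upper range starts one unit INSIDE the gap so that the closed edge
`Re ρ = x + 67.5` of the far box is covered without a boundary device; all terms are `≥ 0`).
* `leaf1Bound x` — the sum of the six pieces, written in exactly the syntactic shape the four analytic lemmas produce
  (so …KernelShiftLeafClose closes by `linarith`);
* `26 ≤ log(γ/2π)` for `γ > T_PT` is the LANDED `RegistryForm.log_div_twoPi_ge` (…StubFarLogKernelSharp, #CA402(2)) — used
  BY NAME, not restated (v2 of this image: the v1 copies `twentySix_le_log` / `log_pos_of_T_PT_lt` were verbatim duplicates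
  of that tree lemma / of C3's row 12 and would have bounced `dedup.landed`);
* `log_twoPi_le` — `log 2π ≤ 1.85`; `log_le_affine32` — `log y ≤ 2.465736 + y/32` (`y > 0`; tangent of `log` at `32`,
  `log 32 = 5 log 2`), used on `y = log t`;
* ★ `leaf1Bound_le (hγ : T_PT < γ) (hx : |x − γ| ≤ boxHalfWidth) : leaf1Bound x ≤ 105/10000 · log(γ/2π)`.
Ledger of the proof (slope per `L = log(γ/2π)`, at the worst case `L = 26`): main terms `(2/67.5 + 2/66.5)·0.15916 = 0.0095026`,
HSW envelopes `(4/67.5² + 4/66.5²)·(0.11184·M + 11.0838)` with `M = log((x+66.5)/2π) ≤ L + 10⁻¹⁰`, i.e. slope `0.0001994`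
and constant `0.019756`; negligible: `10⁻⁹`, `(2/x)·log((x+66.5)/66.5)/(2π) ≤ 10⁻¹²·(M + 1.85)·0.15916`,
`(0.1038 + 0.2573/log T₀)·2/(66.5 T₀) ≤ 0.3611·10⁻¹³`; total `0.009702·26 + 0.019756 = 0.27201 ≤ 0.0105·26 = 0.273`.
Nothing here bears on the truth of RH; RH is not proved; 24730 OPEN.
-/

noncomputable section

set_option linter.dupNamespace false

namespace Summit.RiemannHypothesis.RiemannHypothesis.Theorems.EarlyAppointmentsRemainder0Xi.KernelShiftNumerics

open Real
open Summit.RiemannHypothesis.RiemannHypothesis.Cruxes.Remainder0Xi.Rho2V2 (T_PT boxHalfWidth)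

/-- ★ The explicit LEAF-1 majorant at the real point `x` (box `|x − γ| ≤ 67.5`): lower Abel/HSW side on `(0, x − 67.5]`
(main term, HSW envelope at `x − 67.5` against `2ψ(x − 67.5) = 4/67.5²`, the `(0, 14]` piece `≤ 10⁻⁹`) + upper BPT side on
`(x + 66.5, ∞)` (T-uniform main term, envelope at `T₀ = x + 66.5` against `2ψ(T₀) = 4/66.5²`, the `∫ψ/t` tail). -/
def leaf1Bound (x : ℝ) : ℝ :=
    Real.log ((x - boxHalfWidth) / (2 * Real.pi)) * (2 / boxHalfWidth) / (2 * Real.pi)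
  + ((0.1038 * Real.log (x - boxHalfWidth) + 0.2573 * Real.log (Real.log (x - boxHalfWidth)) + 10.2425)
      * (4 / boxHalfWidth ^ 2) + 1 / 10 ^ 9)
  + (2 * Real.log ((x + (boxHalfWidth - 1)) / (2 * Real.pi)) / ((x + (boxHalfWidth - 1)) - x)
      + 2 / x * Real.log ((x + (boxHalfWidth - 1)) / ((x + (boxHalfWidth - 1)) - x))) / (2 * Real.pi)
  + (0.1038 * Real.log (x + (boxHalfWidth - 1)) + 0.2573 * Real.log (Real.log (x + (boxHalfWidth - 1))) + 10.2425)
      * (4 / (boxHalfWidth - 1) ^ 2)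
  + (0.1038 + 0.2573 / Real.log (x + (boxHalfWidth - 1)))
      * (2 / (((x + (boxHalfWidth - 1)) - x) * (x + (boxHalfWidth - 1))))

/-- `log 2π ≤ 1.85` (`log 2 < 0.6931471808`, `log π = 1 + log(π/e) ≤ π/e ≤ 3.141593/2.7182818283`). -/
theorem log_twoPi_le : Real.log (2 * π) ≤ 1.85 := by
  have h2 := Real.log_two_lt_d9
  have hπ := Real.pi_lt_d6
  have he := Real.exp_one_gt_d9
  have hπ0 := Real.pi_pos
  have he0 := Real.exp_pos 1
  have h1 : Real.log π = 1 + Real.log (π / Real.exp 1) := by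
    rw [Real.log_div hπ0.ne' he0.ne', Real.log_exp]
    ring
  have h3 : Real.log (π / Real.exp 1) ≤ π / Real.exp 1 - 1 := Real.log_le_sub_one_of_pos (by positivity)
  have h4 : π / Real.exp 1 ≤ 3.141593 / 2.7182818283 := by
    rw [div_le_div_iff₀ he0 (by norm_num)]
    linarith
  have h5 : (3.141593 : ℝ) / 2.7182818283 ≤ 1.1558 := by norm_num
  rw [Real.log_mul (by norm_num) hπ0.ne']
  linarith

/-- the tangent of `log` at `32`: `log y ≤ 2.465736 + y/32` for `y > 0` (`log 32 = 5 log 2 ≤ 3.465735904`). -/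
theorem log_le_affine32 {y : ℝ} (hy : 0 < y) : Real.log y ≤ 2.465736 + y / 32 := by
  have h2 := Real.log_two_lt_d9
  have h1 : Real.log y = Real.log 32 + Real.log (y / 32) := by
    rw [Real.log_div hy.ne' (by norm_num)]
    ring
  have h32 : Real.log 32 = 5 * Real.log 2 := by
    rw [show (32 : ℝ) = 2 ^ 5 by norm_num, Real.log_pow]
    norm_num
  have h3 : Real.log (y / 32) ≤ y / 32 - 1 := Real.log_le_sub_one_of_pos (by positivity)
  rw [h1, h32]
  linarith

/-- `a/(2π) ≤ 0.15916·a` for `a ≥ 0` (`0.15916 · 2 · 3.141592 > 1`). -/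
theorem div_twoPi_le {a : ℝ} (ha : 0 ≤ a) : a / (2 * π) ≤ a * 0.15916 := by
  have hπ3 : 3.141592 < π := Real.pi_gt_d6
  have h2π0 : 0 < 2 * π := by positivity
  have h1 : 1 / (2 * π) ≤ 0.15916 := by
    rw [div_le_iff₀ h2π0]
    linarith
  calc a / (2 * π) = a * (1 / (2 * π)) := by ring
    _ ≤ a * 0.15916 := mul_le_mul_of_nonneg_left h1 ha

/-- the height shift: `0 < t ≤ γ + 134`, `γ > T_PT` ⇒ `log(t/2π) ≤ log(γ/2π) + 10⁻¹⁰`. -/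
theorem log_shift_le {γ t : ℝ} (hγ : T_PT < γ) (ht0 : 0 < t) (htγ : t ≤ γ + 134) :
    Real.log (t / (2 * π)) ≤ Real.log (γ / (2 * π)) + 1 / 10 ^ 10 := by
  have hγ' : (3000175332800 : ℝ) < γ := hγ
  have h2π0 : 0 < 2 * π := by positivity
  have hγ0 : 0 < γ := by linarith
  have e : Real.log (t / (2 * π)) - Real.log (γ / (2 * π)) = Real.log (t / γ) := by
    rw [Real.log_div ht0.ne' h2π0.ne', Real.log_div hγ0.ne' h2π0.ne', Real.log_div ht0.ne' hγ0.ne']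
    ring
  have h1 : Real.log (t / γ) ≤ t / γ - 1 := Real.log_le_sub_one_of_pos (by positivity)
  have h2 : t / γ - 1 ≤ 1 / 10 ^ 10 := by
    rw [div_sub_one hγ0.ne', div_le_div_iff₀ hγ0 (by norm_num)]
    linarith
  linarith

/-- `log t = log(t/2π) + log 2π ≤ log(t/2π) + 1.85`. -/
theorem log_le_logDiv_add {t : ℝ} (ht0 : 0 < t) : Real.log t ≤ Real.log (t / (2 * π)) + 1.85 := by
  have h2π0 : 0 < 2 * π := by positivity
  have h := log_twoPi_le
  rw [Real.log_div ht0.ne' h2π0.ne']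
  linarith

/-- the HSW envelope `W_N(s) = 0.1038 log s + 0.2573 log log s + 10.2425` along `e ≤ s ≤ t`, in terms of `M = log(t/2π)`. -/
theorem envelope_le {s t : ℝ} (hs : Real.exp 1 ≤ s) (hst : s ≤ t) :
    0.1038 * Real.log s + 0.2573 * Real.log (Real.log s) + 10.2425 ≤
      0.1038 * (Real.log (t / (2 * π)) + 1.85)
        + 0.2573 * (2.465736 + (Real.log (t / (2 * π)) + 1.85) / 32) + 10.2425 := by
  have hs0 : 0 < s := (Real.exp_pos 1).trans_le hs
  have ht0 : 0 < t := hs0.trans_le hst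
  have hls1 : 1 ≤ Real.log s := by rwa [Real.le_log_iff_exp_le hs0]
  have hls : Real.log s ≤ Real.log t := Real.log_le_log hs0 hst
  have hlt : Real.log t ≤ Real.log (t / (2 * π)) + 1.85 := log_le_logDiv_add ht0
  have hll : Real.log (Real.log s) ≤ Real.log (Real.log t) := Real.log_le_log (by linarith) hls
  have hll' : Real.log (Real.log t) ≤ 2.465736 + Real.log t / 32 := log_le_affine32 (by linarith)
  linarith

/-- the boundary logarithm of the upper side: `(2/x)·log(t/66.5) ≤ 10⁻¹²·(log(t/2π) + 1.85)` for `x ≥ 2·10¹²`, `t ≥ 66.5`. -/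
theorem boundaryLog_le {x t : ℝ} (hx : 2000000000000 ≤ x) (ht : 133 / 2 ≤ t) :
    2 / x * Real.log (t / (133 / 2)) ≤ 1 / 10 ^ 12 * (Real.log (t / (2 * π)) + 1.85) := by
  have hxpos : 0 < x := by linarith
  have ht0 : 0 < t := by linarith
  have h2x : 2 / x ≤ 1 / 10 ^ 12 := by
    rw [div_le_div_iff₀ hxpos (by norm_num)]
    linarith
  have hl4 : Real.log (t / (133 / 2)) ≤ Real.log t :=
    Real.log_le_log (div_pos ht0 (by norm_num)) (div_le_self ht0.le (by norm_num))
  have hl40 : 0 ≤ Real.log (t / (133 / 2)) := by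
    apply Real.log_nonneg
    rw [le_div_iff₀ (by norm_num)]
    linarith
  have hlt := log_le_logDiv_add ht0
  calc 2 / x * Real.log (t / (133 / 2)) ≤ 1 / 10 ^ 12 * Real.log (t / (133 / 2)) :=
        mul_le_mul_of_nonneg_right h2x hl40
    _ ≤ 1 / 10 ^ 12 * (Real.log (t / (2 * π)) + 1.85) :=
        mul_le_mul_of_nonneg_left (hl4.trans hlt) (by norm_num)

/-- The boundary term `(2/x)·log(t/(133/2))` is nonnegative for `0 < x` and `133/2 ≤ t`. -/
theorem boundaryLog_nonneg {x t : ℝ} (hx : 0 < x) (ht : 133 / 2 ≤ t) : 0 ≤ 2 / x * Real.log (t / (133 / 2)) := by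
  refine mul_nonneg (div_nonneg (by norm_num) hx.le) (Real.log_nonneg ?_)
  rw [le_div_iff₀ (by norm_num)]
  linarith

/-- the `∫ψ/t` tail of the upper side: `(0.1038 + 0.2573/log t)·2/(66.5 t) ≤ 0.3611·10⁻¹³` for `t ≥ 3·10¹²`. -/
theorem tail_le {t : ℝ} (ht : 3000000000000 ≤ t) :
    (0.1038 + 0.2573 / Real.log t) * (2 / (133 / 2 * t)) ≤ 0.3611 * (1 / 10 ^ 13) := by
  have ht0 : 0 < t := by linarith
  have hlogt1 : 1 ≤ Real.log t := by
    rw [Real.le_log_iff_exp_le ht0]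
    linarith [Real.exp_one_lt_d9]
  have hcoef : 0.1038 + 0.2573 / Real.log t ≤ 0.3611 := by
    have : 0.2573 / Real.log t ≤ 0.2573 := div_le_self (by norm_num) hlogt1
    linarith
  have hp6a : 2 / (133 / 2 * t) ≤ 1 / 10 ^ 13 := by
    rw [div_le_div_iff₀ (by positivity) (by norm_num)]
    linarith
  exact mul_le_mul hcoef hp6a (by positivity) (by norm_num)

/-- ★ (K) **THE NUMERIC LEAF-1 INEQUALITY**: for `γ > T_PT` and `|x − γ| ≤ 67.5`, `leaf1Bound x ≤ (105/10000)·log(γ/2π)`. -/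
theorem leaf1Bound_le {γ x : ℝ} (hγ : T_PT < γ) (hx : |x - γ| ≤ boxHalfWidth) :
    leaf1Bound x ≤ 105 / 10000 * Real.log (γ / (2 * Real.pi)) := by
  have hB : boxHalfWidth = 135 / 2 := rfl
  have hγ' : (3000175332800 : ℝ) < γ := hγ
  have hL := RegistryForm.log_div_twoPi_ge hγ
  obtain ⟨hx1, hx2⟩ := abs_le.1 hx
  rw [hB] at hx1 hx2
  unfold leaf1Bound
  rw [hB]
  set t₀ : ℝ := x + (135 / 2 - 1) with ht₀
  have hxt : t₀ - x = 133 / 2 := by rw [ht₀]; ring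
  rw [hxt]
  have h2π0 : 0 < 2 * π := by positivity
  have hx0 : 2000000000000 ≤ x := by linarith
  have hxpos : 0 < x := by linarith
  have ht₀ge : 3000000000000 ≤ t₀ := by rw [ht₀]; linarith
  have ht₀0 : 0 < t₀ := by linarith
  have ht₀γ : t₀ ≤ γ + 134 := by rw [ht₀]; linarith
  have hxm0 : 0 < x - 135 / 2 := by linarith
  have hxmt : x - 135 / 2 ≤ t₀ := by rw [ht₀]; linarith
  have hexm : Real.exp 1 ≤ x - 135 / 2 := by linarith [Real.exp_one_lt_d9]
  have hext : Real.exp 1 ≤ t₀ := by linarith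
  set M : ℝ := Real.log (t₀ / (2 * π)) with hM
  -- the height shift `M ≤ L + 10⁻¹⁰` and `M ≥ 0`
  have hML : M ≤ Real.log (γ / (2 * π)) + 1 / 10 ^ 10 := log_shift_le hγ ht₀0 ht₀γ
  have hM0 : 0 ≤ M := by
    apply Real.log_nonneg
    rw [le_div_iff₀ h2π0]
    linarith [Real.pi_lt_d6]
  -- piece 1 (lower main term)
  have hp1 : Real.log ((x - 135 / 2) / (2 * π)) ≤ M :=
    Real.log_le_log (div_pos hxm0 h2π0) (div_le_div_of_nonneg_right hxmt h2π0.le)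
  have hp10 : 0 ≤ Real.log ((x - 135 / 2) / (2 * π)) := by
    apply Real.log_nonneg
    rw [le_div_iff₀ h2π0]
    linarith [Real.pi_lt_d6]
  have hp1' : Real.log ((x - 135 / 2) / (2 * π)) * (2 / (135 / 2)) / (2 * π)
      ≤ Real.log ((x - 135 / 2) / (2 * π)) * (2 / (135 / 2)) * 0.15916 := div_twoPi_le (by positivity)
  -- pieces 2 and 5 (HSW envelopes)
  have hW1 : (0.1038 * Real.log (x - 135 / 2) + 0.2573 * Real.log (Real.log (x - 135 / 2)) + 10.2425)
        * (4 / (135 / 2) ^ 2)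
      ≤ (0.1038 * (M + 1.85) + 0.2573 * (2.465736 + (M + 1.85) / 32) + 10.2425) * (4 / (135 / 2) ^ 2) :=
    mul_le_mul_of_nonneg_right (envelope_le hexm hxmt) (by positivity)
  have hW2 : (0.1038 * Real.log t₀ + 0.2573 * Real.log (Real.log t₀) + 10.2425) * (4 / (135 / 2 - 1) ^ 2)
      ≤ (0.1038 * (M + 1.85) + 0.2573 * (2.465736 + (M + 1.85) / 32) + 10.2425) * (4 / (135 / 2 - 1) ^ 2) :=
    mul_le_mul_of_nonneg_right (envelope_le hext le_rfl) (by positivity)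
  -- piece 4 (upper main term, T-uniform)
  have hp4b : 2 / x * Real.log (t₀ / (133 / 2)) ≤ 1 / 10 ^ 12 * (M + 1.85) := boundaryLog_le hx0 (by linarith)
  have hp40 : 0 ≤ 2 / x * Real.log (t₀ / (133 / 2)) := boundaryLog_nonneg hxpos (by linarith)
  have hp4' : (2 * M / (133 / 2) + 2 / x * Real.log (t₀ / (133 / 2))) / (2 * π)
      ≤ (2 * M / (133 / 2) + 2 / x * Real.log (t₀ / (133 / 2))) * 0.15916 :=
    div_twoPi_le (add_nonneg (div_nonneg (by linarith) (by norm_num)) hp40)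
  -- piece 6 (the `∫ψ/t` tail)
  have hp6 : (0.1038 + 0.2573 / Real.log t₀) * (2 / (133 / 2 * t₀)) ≤ 0.3611 * (1 / 10 ^ 13) := tail_le ht₀ge
  -- the ledger
  linarith

end Summit.RiemannHypothesis.RiemannHypothesis.Theorems.EarlyAppointmentsRemainder0Xi.KernelShiftNumerics

end
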